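import Summits.AtomisticToContinuum.HydrodynamicLimit.Theorems.OneFlightGossipEngineEnergyCurrentTailsSplitLagged
import Summits.AtomisticToContinuum.HydrodynamicLimit.Theorems.OneFlightGossipEngineEnergyCurrentTailsWindowRateFloorGlue
import Summits.AtomisticToContinuum.HydrodynamicLimit.Theorems.OneFlightGossipEngineEnergyCurrentTailsMixingFloor4LOffsetAveraging
import Summits.AtomisticToContinuum.HydrodynamicLimit.Theorems.OneFlightGossipEngineEnergyCurrentTailsFirstPartnerPathwise
import HarnessLib

/-!
# Crux `EnergyCurrentTails` (stmt-AtomisticToContinuum-9235), line `quartic-schur-ledger`: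
# the composition from the FIRST-PARTNER primitives (seat c6 reshape B)

With the lagged kinetic-window mixing floor QMF₄ᴸ derived from the mesoscopic first-partner floor T′
(`FirstPartnerFloorMeso`), the realised share I′ (`FirstPartnerRealisedShare`) and the sure pathwise transfer P
(`stub_firstPartnerPathwise`) through the landed glue G1 (`stub_windowMixingRateFloor_of_firstPartner`) and G2
(`stub_quarticMixingFloor4L_of_windowRateFloor`, offset averaging), the seat-c6 composition
`EnergyCurrentTails_of_mixingFloor4L : QMF₄ᴸ → S2a″ → EnergyCurrentTails` gives:

* `EnergyCurrentTails_of_firstPartner : T′ → I′ → S2a″ → EnergyCurrentTails` — the crux is CLOSED MODULO exactly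
  {T′, I′, S2a″}: one STATIC MESOSCOPIC FLOOR under the fixed-time law (T′) and two CEILINGS of Enskog type (I′ one-rare,
  S2a″ bulk — typed producer stmt-AtomisticToContinuum-16939);
* `EnergyCurrentTails_warmCold_of_firstPartner` — the same with the item's primary copy.
-/

noncomputable section

namespace Summit.AtomisticToContinuum.HydrodynamicLimit.Theorems.QuarticSchurLedger

open Literature.MathematicalPhysics.KineticTheory Literature.Analysis.FluidPDE
open Summit.AtomisticToContinuum.HydrodynamicLimit.Theorems.EnergyCurrentTailsFirstPartner

/-- **The crux from the first-partner primitives and the flux ceiling: T′ → I′ → S2a″ → `EnergyCurrentTails`**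
(line `quartic-schur-ledger`, crux stmt-AtomisticToContinuum-9235; seat c6 reshape B).  Proof:
`EnergyCurrentTails_of_mixingFloor4L (G2 (G1 T′ I′ P)) S2a″` with the landed P `stub_firstPartnerPathwise`. -/
theorem EnergyCurrentTails_of_firstPartner :
    Summit.AtomisticToContinuum.HydrodynamicLimit.Theorems.EnergyCurrentTailsFirstPartner.FirstPartnerFloorMeso
    →
    Summit.AtomisticToContinuum.HydrodynamicLimit.Theorems.EnergyCurrentTailsFirstPartner.FirstPartnerRealisedShare
    → (∀ (a₀ θ₀ : T3 → ℝ) (u₀ : T3 → V3), Continuous a₀ → Continuous θ₀ → Continuous u₀ → (∀ x, 0 < a₀ x) →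
    (∀ x, 0 < θ₀ x) → ∃ σ₀ : ℝ, 0 < σ₀ ∧ ∀ σ : ℝ, 0 < σ → σ < σ₀ → ∀ T : ℝ, 0 < T → ∀ Φ : ((N : ℕ) →
    HardSphereFlow (Torus.geometry (Fin 3)) (hsDiameter σ N) (N + 1)), ∃ C : ℝ, 0 ≤ C ∧ ∃ N₀ : ℕ, ∀ N : ℕ,
    N₀ ≤ N → ∀ s s' : ℝ, 0 ≤ s → s ≤ s' → s' ≤ T → (∫⁻ z, ENNReal.ofReal (((N : ℝ) + 1)⁻¹ * (Φ
    N).collisionSum (Set.Ioc s s') (fun col => ‖col.preVel.1‖ ^ 2 * ‖col.preVel.2‖ ^ 2) z) ∂(localGibbsLaw σ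
    a₀ u₀ θ₀ N (Φ N))) ≤ ENNReal.ofReal (C * (σ ^ 2 * ((N : ℝ) + 1) ^ (1 / 3 : ℝ) * (s' - s))) * (⨆ r ∈
    Set.Icc s s', (∫⁻ z, ENNReal.ofReal (((N : ℝ) + 1)⁻¹ * ∑ i : Fin (N + 1), ‖((Φ N).flow r z i).2‖ ^ 2)
    ∂(localGibbsLaw σ a₀ u₀ θ₀ N (Φ N)))) * (⨆ r ∈ Set.Icc s s', (∫⁻ z, ENNReal.ofReal (((N : ℝ) + 1)⁻¹ * ∑
    i : Fin (N + 1), ‖((Φ N).flow r z i).2‖ ^ 3) ∂(localGibbsLaw σ a₀ u₀ θ₀ N (Φ N))))) →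
    Summit.AtomisticToContinuum.HydrodynamicLimit.Theses.OneFlightGossipEngine.EnergyCurrentTails :=
  fun hT hI hW => EnergyCurrentTails_of_mixingFloor4L
    (stub_quarticMixingFloor4L_of_windowRateFloor
      (stub_windowMixingRateFloor_of_firstPartner hT hI stub_firstPartnerPathwise)) hW

/-- **The same with the item's primary copy `WarmColdDichotomy.EnergyCurrentTails`.** -/
theorem EnergyCurrentTails_warmCold_of_firstPartner :
    Summit.AtomisticToContinuum.HydrodynamicLimit.Theorems.EnergyCurrentTailsFirstPartner.FirstPartnerFloorMeso
    →
    Summit.AtomisticToContinuum.HydrodynamicLimit.Theorems.EnergyCurrentTailsFirstPartner.FirstPartnerRealisedShare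
    → (∀ (a₀ θ₀ : T3 → ℝ) (u₀ : T3 → V3), Continuous a₀ → Continuous θ₀ → Continuous u₀ → (∀ x, 0 < a₀ x) →
    (∀ x, 0 < θ₀ x) → ∃ σ₀ : ℝ, 0 < σ₀ ∧ ∀ σ : ℝ, 0 < σ → σ < σ₀ → ∀ T : ℝ, 0 < T → ∀ Φ : ((N : ℕ) →
    HardSphereFlow (Torus.geometry (Fin 3)) (hsDiameter σ N) (N + 1)), ∃ C : ℝ, 0 ≤ C ∧ ∃ N₀ : ℕ, ∀ N : ℕ,
    N₀ ≤ N → ∀ s s' : ℝ, 0 ≤ s → s ≤ s' → s' ≤ T → (∫⁻ z, ENNReal.ofReal (((N : ℝ) + 1)⁻¹ * (Φ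
    N).collisionSum (Set.Ioc s s') (fun col => ‖col.preVel.1‖ ^ 2 * ‖col.preVel.2‖ ^ 2) z) ∂(localGibbsLaw σ
    a₀ u₀ θ₀ N (Φ N))) ≤ ENNReal.ofReal (C * (σ ^ 2 * ((N : ℝ) + 1) ^ (1 / 3 : ℝ) * (s' - s))) * (⨆ r ∈
    Set.Icc s s', (∫⁻ z, ENNReal.ofReal (((N : ℝ) + 1)⁻¹ * ∑ i : Fin (N + 1), ‖((Φ N).flow r z i).2‖ ^ 2)
    ∂(localGibbsLaw σ a₀ u₀ θ₀ N (Φ N)))) * (⨆ r ∈ Set.Icc s s', (∫⁻ z, ENNReal.ofReal (((N : ℝ) + 1)⁻¹ * ∑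
    i : Fin (N + 1), ‖((Φ N).flow r z i).2‖ ^ 3) ∂(localGibbsLaw σ a₀ u₀ θ₀ N (Φ N))))) →
    Summit.AtomisticToContinuum.HydrodynamicLimit.Theses.WarmColdDichotomy.EnergyCurrentTails :=
  fun hT hI hW => EnergyCurrentTails_of_firstPartner hT hI hW

end Summit.AtomisticToContinuum.HydrodynamicLimit.Theorems.QuarticSchurLedger

end
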